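import Summits.HodgeConjecture.HodgeConjecture.Theorems.Ring2WeilCoverageProductWindow
import Summits.HodgeConjecture.HodgeConjecture.Theorems.Ring2WeilNormObstructionDescentCensus
import HarnessLib

/-!
# Weil-type family coverage — THEOREM S7 (the CARRIER-FREE product-window law), part H: its arithmetic skeleton with a free carrier
# constant, and the first data of the SEMIDIHEDRAL carrier `SD₁₆` of `ℚ(√-2)`: the row `W6.2.7 = (3, ℚ(√-2), [7])` REACHED

research route conditional on HC_CM; not a corollary; Q11.4-sentence-2 already refuted in dim ≥ 3.

Ring 2, WEIL-TYPE FAMILY-COVERAGE CENSUS (`HOME/WEIL-FAMILY-COVERAGE.md` `## b04`, block b04.14, owner ring2-b04, gen 50; docstring revision 2 —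
census ERRATUM E-b04.14-2, theorems byte-identical); eighth part of
`Ring2WeilCoverageProductWindow` (imports part A for the §1 lemmas `mk_pow_odd_eq_mk` / `mk_pow_even_eq_mk_one`).  THEOREM S7 (census b04.14 (A), proof in the block and in the mirror file
`pub-hodge-ring2-b04/census-g50/THEOREMS-S7.md`): for a CARRIER `(G₁, λ, H₁)` — `λ ∈ Irr(G₁)`, `ℚ(λ) = K = ℚ(√-d)`, Schur index 1,
`⟨λ|H₁, 1⟩ = 1` — whose character has `p`-defect zero at every prime `p` inert in `K` (THEOREM S3's `S_in(G₁,λ) = ∅`) and `|Ram(K)| = 1`,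
and any 2-transitive `G₂` of degree `n` with point stabiliser `H₂`, the HIDDEN FACTOR `B = (e_λ e_ρ H¹(C̃,ℚ))^{H₁×H₂}` of ANY
`(G₁ × G₂)`-curve has `[a_B] = [n]^{r₁}·[|H₂|·u]^{m}` in `ℚˣ/Nm(Kˣ)` with `u = u(G₁,λ,H₁)` a constant of the carrier (LEMMA C′: the
`H₁`-slice of the `λ`-block of EVERY `G₁`-curve has class `u^{rank}` — block theory of S3 + Morita + a tensor splitting of unimodularity
over the unramified d.v.r.), `m = dim_K B`, `r₁ = ⟨H¹(C̃/G₂), λ⟩`; for `B` of WEIL TYPE (`m` even) the constant drops out: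
`[a_B] = [n]^{r₁}`, whatever the carrier.  New minimal carrier: the semidihedral group `SD₁₆ = {i ↦ a·i + b on ℤ/8 : a ∈ {1,3}}`,
`λ = Ind_{C₈} ζ₈` (`λ(x) = ζ₈ + ζ₈³ = √-2`), `H₁ = ⟨i ↦ 3i⟩`; the inert primes of `ℚ(√-2)` are odd, so `S_in = ∅`.

* §1 the arithmetic skeleton with a FREE carrier constant `u` (any `d`): `[(n·h·u)^r · (h·u)^{r+2k}] = [n^r]`,
  `[(n·h·u)^r · (h·u)^{r+2k+1}] = [n^r·(h·u)]`; corollaries `SD₁₆ × PSL₂(7)` (`n = 7`, `|H₂| = 24`): odd `r₁` ⟹ class `[7]`, NOT a norm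
  class from `ℚ(√-2)` (ring2-b02's `seven_not_mem_norm_two`); `SD₁₆ × A₅` (`n = 5`, `|H₂| = 12`): odd `r₁` ⟹ `[5]`, non-norm; even
  `r₁` ⟹ norm.
* §2 literal classes (engine `cosetwin.py`, the hidden factor computed on the coset cover `C̃/(H₁ × H₂)` with its own polarisation —
  for `m` even the same class as on `C̃` — exact rational arithmetic; mirror `census-g50/`): `SD₁₆ × PSL₂(7)` rigid curves of genus
  457/457/505: `(3,3)` Weil-type SIXFOLDS with `det H = -1/28, -1/14, -2/7`, `T = {2,7}`: **row `W6.2.7 = (3, ℚ(√-2), [7])`** (pub-hsemireg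
  R4, `ℚ(√-2)`, `a = 7`; the smallest-genus PRODUCT-WINDOW members of the row and the first on the `SD₁₆` carrier — ring2-b02's census
  b02.21 (2026-08-23T16:43Z, earlier) reached the row with `GL₂(3) × L₃(2)`: rigid curves of genus 1321/1417/1513 and a one-parameter family
  of genus 2185; CM points with a curve were on the row before that (ring2-b05 b05.11 Fermat points, ring2-b03 b03.20 `Dic₇`); census
  ERRATUM E-b04.14-2 corrects the first printing of this sentence) and an eightfold on `W8.2.7` (genus 617); `SD₁₆ × A₅` rigid sixfolds on `W6.2.5` (genus 317) and eightfolds on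
  `W8.2.5` (333/349); `SD₁₆ × F₂₀` ONE-PARAMETER tenfold/eightfold families of genus 141 on `W10.2.5` / `W8.2.5` and the even-`r₁`
  CONTROL family of genus 161 on the split row `W10.2.1`; all 11 as S7 predicts (`[n]^{r₁}`).  Also the `C₃ × F₂₀` two-parameter TENFOLD
  of genus 56 on `W10.3.5` (habitat2's D-3 of REACH-X2-B against census b04.13 (P4) «tenfold g 60»: resolved in habitat2's favour,
  ERRATUM E-b04.14-1).

No `def`, no named fact, no `sorry`; nothing here is a statement about Hodge classes; `HC_CM` is used nowhere.
References: [cite: vanGeemen1994HodgeAV, (5.4.1), Lemma 5.2]; [cite: Serre1973, Ch. III §1].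
-/

set_option linter.dupNamespace false

open Literature.AlgebraicGeometry.Motives
open Literature.AlgebraicGeometry.VanGeemen1994
open Summit.HodgeConjecture.HodgeConjecture.Ring2.Hypotheses

namespace Summit.HodgeConjecture.HodgeConjecture.Ring2.WeilCoverage

/-! ### §1 THEOREM S7's arithmetic skeleton (free carrier constant) -/

/-- **THEOREM S7, arithmetic form.** In `ℚˣ/Nm(K_dˣ)` (any `d`), for ANY rationals `h, u ≠ 0` (`h = |H₂|`, or `|H₁|` in the coset
normalisation; `u` = the carrier constant of LEMMA C′) and `m = 2k` EVEN (Weil type): `[(n·h·u)^r · (h·u)^{r+2k}] = [n^r]` — the law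
`[a_B] = [|G₂|u]^{r₁}·[|H₂|u]^{r₁+m}` collapses to `[n]^{r₁}` because `(nhu)^r (hu)^{r+2k} · n^r = (n^r (hu)^{r+k})²` is a square, hence a norm.
research route conditional on HC_CM; not a corollary; Q11.4-sentence-2 already refuted in dim ≥ 3. [cite: vanGeemen1994HodgeAV, Lemma 5.2 (3)] -/
theorem carrierWindow_mk_eq_mk_pow (d n : ℕ) (h u : ℚ) (r k : ℕ) (hn : (n : ℚ) ≠ 0) (hh : h ≠ 0) (hu : u ≠ 0) :
    (QuotientGroup.mk (Units.mk0 (((n : ℚ) * h * u) ^ r * (h * u) ^ (r + 2 * k))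
        (mul_ne_zero (pow_ne_zero _ (mul_ne_zero (mul_ne_zero hn hh) hu)) (pow_ne_zero _ (mul_ne_zero hh hu)))) :
        weilNormResidueGroup d) =
      QuotientGroup.mk (Units.mk0 ((n : ℚ) ^ r) (pow_ne_zero _ hn)) :=
  mk_eq_mk_of_mul_mem _ _
    (mem_normUnitsSubgroup_of_sq_add_mul_sq _ ((n : ℚ) ^ r * (h * u) ^ (r + k)) 0 (by ring))

/-- The same for `m = 2k + 1` ODD: `[(n·h·u)^r · (h·u)^{r+2k+1}] = [n^r · (h·u)]` — the carrier constant survives exactly once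
(`(nhu)^r (hu)^{r+2k+1} · n^r (hu) = (n^r (hu)^{r+k+1})²`).
research route conditional on HC_CM; not a corollary; Q11.4-sentence-2 already refuted in dim ≥ 3. [cite: vanGeemen1994HodgeAV, Lemma 5.2 (3)] -/
theorem carrierWindow_mk_eq_mk_pow_odd (d n : ℕ) (h u : ℚ) (r k : ℕ) (hn : (n : ℚ) ≠ 0) (hh : h ≠ 0) (hu : u ≠ 0) :
    (QuotientGroup.mk (Units.mk0 (((n : ℚ) * h * u) ^ r * (h * u) ^ (r + 2 * k + 1))
        (mul_ne_zero (pow_ne_zero _ (mul_ne_zero (mul_ne_zero hn hh) hu)) (pow_ne_zero _ (mul_ne_zero hh hu)))) :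
        weilNormResidueGroup d) =
      QuotientGroup.mk (Units.mk0 ((n : ℚ) ^ r * (h * u)) (mul_ne_zero (pow_ne_zero _ hn) (mul_ne_zero hh hu))) :=
  mk_eq_mk_of_mul_mem _ _
    (mem_normUnitsSubgroup_of_sq_add_mul_sq _ ((n : ℚ) ^ r * (h * u) ^ (r + k + 1)) 0 (by ring))

/-- **`SD₁₆ × PSL₂(7)` on 7 points (`n = 7`, `|H₂| = |S₄| = 24`, `K = ℚ(√-2)`), `r₁ = 2j + 1` ODD, `m = 2k`, ANY carrier constant `u ≠ 0`:**
the class `[(7·24·u)^{r₁}·(24·u)^{r₁+m}]` predicted by THEOREM S7 is `[7]`, NOT a norm class from `ℚ(√-2)` (`7 ≡ 7 (mod 8)` inert;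
ring2-b02's `seven_not_mem_norm_two`): a Weil-type hidden factor with odd `r₁` lies on the NON-split row `W(m).2.7` — for `m = 6` the
row `(3, ℚ(√-2), [7])` of pub-hsemireg's R4; the three rigid curves of §2 have `r₁ = 1`.
research route conditional on HC_CM; not a corollary; Q11.4-sentence-2 already refuted in dim ≥ 3. [cite: vanGeemen1994HodgeAV, (5.4.1)] -/
theorem carrierWindow_SD16L27_odd_not_mem_norm (u : ℚ) (hu : u ≠ 0) (j k : ℕ) :
    Units.mk0 ((((7 : ℕ) : ℚ) * 24 * u) ^ (2 * j + 1) * ((24 : ℚ) * u) ^ (2 * j + 1 + 2 * k))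
        (mul_ne_zero (pow_ne_zero _ (mul_ne_zero (mul_ne_zero (by norm_num) (by norm_num)) hu))
          (pow_ne_zero _ (mul_ne_zero (by norm_num) hu))) ∉ normUnitsSubgroup ℚ (weilField 2) := by
  intro hmem
  have h1 := carrierWindow_mk_eq_mk_pow 2 7 24 u (2 * j + 1) k (by norm_num) (by norm_num) hu
  have h2 := mk_pow_odd_eq_mk 2 7 j (by norm_num)
  have h3 : (QuotientGroup.mk (Units.mk0 ((((7 : ℕ) : ℚ) * 24 * u) ^ (2 * j + 1) * ((24 : ℚ) * u) ^ (2 * j + 1 + 2 * k))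
      (mul_ne_zero (pow_ne_zero _ (mul_ne_zero (mul_ne_zero (by norm_num) (by norm_num)) hu))
        (pow_ne_zero _ (mul_ne_zero (by norm_num) hu)))) : weilNormResidueGroup 2) =
      QuotientGroup.mk (Units.mk0 (7 : ℚ) (by norm_num)) := by
    have := h1.trans (by exact_mod_cast h2)
    exact_mod_cast this
  have h4 : (QuotientGroup.mk (Units.mk0 (7 : ℚ) (by norm_num)) : weilNormResidueGroup 2) = 1 := by
    rw [← h3, QuotientGroup.eq_one_iff]
    exact hmem
  exact Summit.HodgeConjecture.Ring2WeilNormDescent.seven_not_mem_norm_two ((QuotientGroup.eq_one_iff _).1 h4)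

/-- **`SD₁₆ × A₅` on 5 points (`n = 5`, `|H₂| = |A₄| = 12`, `K = ℚ(√-2)`), `r₁ = 2j + 1` ODD, any carrier constant:** predicted class
`[5]`, NOT a norm class from `ℚ(√-2)` (`5 ≡ 5 (mod 8)` inert; `five_not_mem_norm_two`): row `W(m).2.5`; the rigid sixfolds of §2 have
`r₁ = 1`, `m = 6`.
research route conditional on HC_CM; not a corollary; Q11.4-sentence-2 already refuted in dim ≥ 3. [cite: vanGeemen1994HodgeAV, (5.4.1)] -/
theorem carrierWindow_SD16A5_odd_not_mem_norm (u : ℚ) (hu : u ≠ 0) (j k : ℕ) :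
    Units.mk0 ((((5 : ℕ) : ℚ) * 12 * u) ^ (2 * j + 1) * ((12 : ℚ) * u) ^ (2 * j + 1 + 2 * k))
        (mul_ne_zero (pow_ne_zero _ (mul_ne_zero (mul_ne_zero (by norm_num) (by norm_num)) hu))
          (pow_ne_zero _ (mul_ne_zero (by norm_num) hu))) ∉ normUnitsSubgroup ℚ (weilField 2) := by
  intro hmem
  have h1 := carrierWindow_mk_eq_mk_pow 2 5 12 u (2 * j + 1) k (by norm_num) (by norm_num) hu
  have h2 := mk_pow_odd_eq_mk 2 5 j (by norm_num)
  have h3 : (QuotientGroup.mk (Units.mk0 ((((5 : ℕ) : ℚ) * 12 * u) ^ (2 * j + 1) * ((12 : ℚ) * u) ^ (2 * j + 1 + 2 * k))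
      (mul_ne_zero (pow_ne_zero _ (mul_ne_zero (mul_ne_zero (by norm_num) (by norm_num)) hu))
        (pow_ne_zero _ (mul_ne_zero (by norm_num) hu)))) : weilNormResidueGroup 2) =
      QuotientGroup.mk (Units.mk0 (5 : ℚ) (by norm_num)) := by
    have := h1.trans (by exact_mod_cast h2)
    exact_mod_cast this
  have h4 : (QuotientGroup.mk (Units.mk0 (5 : ℚ) (by norm_num)) : weilNormResidueGroup 2) = 1 := by
    rw [← h3, QuotientGroup.eq_one_iff]
    exact hmem
  exact Summit.HodgeConjecture.Ring2WeilNormDescent.five_not_mem_norm_two ((QuotientGroup.eq_one_iff _).1 h4)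

/-- **`SD₁₆ × A₅`, `r₁ = 2j` EVEN, any carrier constant:** the predicted class is the NORM class — the Weil-type factor is SPLIT
(row `W(m).2.1`); cf. the `SD₁₆ × F₂₀` control family of genus 161 in §2 (`r₁ = 2`, `T = ∅`).
research route conditional on HC_CM; not a corollary; Q11.4-sentence-2 already refuted in dim ≥ 3. [cite: vanGeemen1994HodgeAV, (5.4.1)] -/
theorem carrierWindow_SD16A5_even_mem_norm (u : ℚ) (hu : u ≠ 0) (j k : ℕ) :
    Units.mk0 ((((5 : ℕ) : ℚ) * 12 * u) ^ (2 * j) * ((12 : ℚ) * u) ^ (2 * j + 2 * k))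
        (mul_ne_zero (pow_ne_zero _ (mul_ne_zero (mul_ne_zero (by norm_num) (by norm_num)) hu))
          (pow_ne_zero _ (mul_ne_zero (by norm_num) hu))) ∈ normUnitsSubgroup ℚ (weilField 2) := by
  have h1 := carrierWindow_mk_eq_mk_pow 2 5 12 u (2 * j) k (by norm_num) (by norm_num) hu
  have h2 := mk_pow_even_eq_mk_one 2 5 j (by norm_num)
  have h3 : (QuotientGroup.mk (Units.mk0 ((((5 : ℕ) : ℚ) * 12 * u) ^ (2 * j) * ((12 : ℚ) * u) ^ (2 * j + 2 * k))
      (mul_ne_zero (pow_ne_zero _ (mul_ne_zero (mul_ne_zero (by norm_num) (by norm_num)) hu))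
        (pow_ne_zero _ (mul_ne_zero (by norm_num) hu)))) : weilNormResidueGroup 2) =
      QuotientGroup.mk (Units.mk0 (1 : ℚ) one_ne_zero) := by
    have := h1.trans (by exact_mod_cast h2)
    exact_mod_cast this
  have h5 := QuotientGroup.eq.1 h3
  have h6 : Units.mk0 (1 : ℚ) one_ne_zero = 1 := Units.ext rfl
  rw [h6, mul_one] at h5
  simpa using Subgroup.inv_mem _ h5

/-! ### §2 The first data of the `SD₁₆` carrier, and the `C₃ × F₂₀` tenfold of genus 56: literal classes and cell identifications -/

/-- `SD₁₆ × PSL₂(7)` (semidihedral carrier of `ℚ(√-2)`; `PSL₂(7)` on 7 points)-cover `(0; 2:22,8a:42,4b:7A)` (genus 457, Hurwitz dimension 0; engine `cosetwin.py` on the coset cover `C̃/(H₁ × Stab(0))`, 56 sheets, genus 9, its own polarisation, exact): the HIDDEN FACTOR `B = V^{H₁×Stab(0)}` of the `(λ⊗ρ)`-piece `P` — an abelian SIXFOLD with `(3,3)` `ℚ(√-2)`-action, WEIL TYPE — has literal `det H|_B = -1/28`, `a = 1/28`, `T(a) = [2, 7]`: row `W6.2.7` (NON-split); `r₁ = dim_K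 H¹(C̃/G₂)_λ = 1`. THEOREM S7 (carrier-free product-window law, census b04.14 (A)) predicts `T(a_B) = [2, 7]` from `r₁ = 1` (`[a_B] = [n]^{r₁}`, `n = 7`) — CONFIRMED.
research route conditional on HC_CM; not a corollary; Q11.4-sentence-2 already refuted in dim ≥ 3. [cite: vanGeemen1994HodgeAV, (5.4.1)] -/
theorem pwSD16L27_222_8a42_4b7A_q0_g457_mk_detH_ne_split :
    (QuotientGroup.mk (Units.mk0 (((-1 : ℚ) / 28)) (by norm_num)) : weilNormResidueGroup 2) ≠
      splitDiscriminantClass 3 2 := by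
  have e : Units.mk0 (((-1 : ℚ) / 28)) (by norm_num) = -(Units.mk0 ((1 : ℚ) / 28) (by norm_num)) := Units.ext (by norm_num)
  rw [Ne, e, mk_neg_eq_splitDiscriminantClass_iff_of_odd (n := 3) (by decide)]
  have h := mul_not_mem_normUnitsSubgroup (mem_normUnitsSubgroup_of_sq_add_mul_sq (d := 2) (a := ((1 : ℚ) / 196)) (by norm_num) ((1 : ℚ) / 14) (0 : ℚ) (by norm_num))
    Summit.HodgeConjecture.Ring2WeilNormDescent.seven_not_mem_norm_two
  rw [mk0_mul_mk0] at h
  norm_num at h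
  exact h

/-- The same datum, CELL IDENTIFICATION: `[det H|_B] = [-7]` in `ℚˣ/Nm(ℚ(√-2)ˣ)` — the census ROW KEY of `W6.2.7` (`a·7 = ((1 : ℚ) / 4) = (((1 : ℚ) / 2))² + 2·((0 : ℚ))²`).
research route conditional on HC_CM; not a corollary; Q11.4-sentence-2 already refuted in dim ≥ 3. [cite: vanGeemen1994HodgeAV, Lemma 5.2 (3)] -/
theorem pwSD16L27_222_8a42_4b7A_q0_g457_mk_detH_eq_key :
    (QuotientGroup.mk (Units.mk0 (-(((1 : ℚ) / 28))) (neg_ne_zero.2 (by norm_num))) : weilNormResidueGroup 2) =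
      QuotientGroup.mk (Units.mk0 (-(7 : ℚ)) (neg_ne_zero.2 (by norm_num))) :=
  mk_neg_eq_mk_neg_of_mul_mem (by norm_num) (by norm_num)
    (mem_normUnitsSubgroup_of_sq_add_mul_sq _ ((1 : ℚ) / 2) (0 : ℚ) (by norm_num))

/-- `SD₁₆ × PSL₂(7)` (semidihedral carrier of `ℚ(√-2)`; `PSL₂(7)` on 7 points)-cover `(0; 2:22,8a:42,4b:7B)` (genus 457, Hurwitz dimension 0; engine `cosetwin.py` on the coset cover `C̃/(H₁ × Stab(0))`, 56 sheets, genus 9, its own polarisation, exact): the HIDDEN FACTOR `B = V^{H₁×Stab(0)}` of the `(λ⊗ρ)`-piece `P` — an abelian SIXFOLD with `(3,3)` `ℚ(√-2)`-action, WEIL TYPE — has literal `det H|_B = -1/14`, `a = 1/14`, `T(a) = [2, 7]`: row `W6.2.7` (NON-split); `r₁ = dim_K H¹(C̃/G₂)_λ = 1`. THEOREM S7 (carrier-free product-window law, census b04.14 (A)) predicts `T(a_B) = [2, 7]` from `r₁ = 1` (`[a_B] = [n]^{r₁}`, `n = 7`) — CONFIRMED.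
research route conditional on HC_CM; not a corollary; Q11.4-sentence-2 already refuted in dim ≥ 3. [cite: vanGeemen1994HodgeAV, (5.4.1)] -/
theorem pwSD16L27_222_8a42_4b7B_q0_g457_mk_detH_ne_split :
    (QuotientGroup.mk (Units.mk0 (((-1 : ℚ) / 14)) (by norm_num)) : weilNormResidueGroup 2) ≠
      splitDiscriminantClass 3 2 := by
  have e : Units.mk0 (((-1 : ℚ) / 14)) (by norm_num) = -(Units.mk0 ((1 : ℚ) / 14) (by norm_num)) := Units.ext (by norm_num)
  rw [Ne, e, mk_neg_eq_splitDiscriminantClass_iff_of_odd (n := 3) (by decide)]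
  have h := mul_not_mem_normUnitsSubgroup (mem_normUnitsSubgroup_of_sq_add_mul_sq (d := 2) (a := ((1 : ℚ) / 98)) (by norm_num) (0 : ℚ) ((1 : ℚ) / 14) (by norm_num))
    Summit.HodgeConjecture.Ring2WeilNormDescent.seven_not_mem_norm_two
  rw [mk0_mul_mk0] at h
  norm_num at h
  exact h

/-- The same datum, CELL IDENTIFICATION: `[det H|_B] = [-7]` in `ℚˣ/Nm(ℚ(√-2)ˣ)` — the census ROW KEY of `W6.2.7` (`a·7 = ((1 : ℚ) / 2) = ((0 : ℚ))² + 2·(((1 : ℚ) / 2))²`).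
research route conditional on HC_CM; not a corollary; Q11.4-sentence-2 already refuted in dim ≥ 3. [cite: vanGeemen1994HodgeAV, Lemma 5.2 (3)] -/
theorem pwSD16L27_222_8a42_4b7B_q0_g457_mk_detH_eq_key :
    (QuotientGroup.mk (Units.mk0 (-(((1 : ℚ) / 14))) (neg_ne_zero.2 (by norm_num))) : weilNormResidueGroup 2) =
      QuotientGroup.mk (Units.mk0 (-(7 : ℚ)) (neg_ne_zero.2 (by norm_num))) :=
  mk_neg_eq_mk_neg_of_mul_mem (by norm_num) (by norm_num)
    (mem_normUnitsSubgroup_of_sq_add_mul_sq _ (0 : ℚ) ((1 : ℚ) / 2) (by norm_num))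

/-- `SD₁₆ × PSL₂(7)` (semidihedral carrier of `ℚ(√-2)`; `PSL₂(7)` on 7 points)-cover `(0; 2:42,8a:42,4b:42)` (genus 505, Hurwitz dimension 0; engine `cosetwin.py` on the coset cover `C̃/(H₁ × Stab(0))`, 56 sheets, genus 8, its own polarisation, exact): the HIDDEN FACTOR `B = V^{H₁×Stab(0)}` of the `(λ⊗ρ)`-piece `P` — an abelian SIXFOLD with `(3,3)` `ℚ(√-2)`-action, WEIL TYPE — has literal `det H|_B = -2/7`, `a = 2/7`, `T(a) = [2, 7]`: row `W6.2.7` (NON-split); `r₁ = dim_K H¹(C̃/G₂)_λ = 1`. THEOREM S7 (carrier-free product-window law, census b04.14 (A)) predicts `T(a_B) = [2, 7]` from `r₁ = 1` (`[a_B] = [n]^{r₁}`, `n = 7`) — CONFIRMED.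
research route conditional on HC_CM; not a corollary; Q11.4-sentence-2 already refuted in dim ≥ 3. [cite: vanGeemen1994HodgeAV, (5.4.1)] -/
theorem pwSD16L27_242_8a42_4b42_q0_g505_mk_detH_ne_split :
    (QuotientGroup.mk (Units.mk0 (((-2 : ℚ) / 7)) (by norm_num)) : weilNormResidueGroup 2) ≠
      splitDiscriminantClass 3 2 := by
  have e : Units.mk0 (((-2 : ℚ) / 7)) (by norm_num) = -(Units.mk0 ((2 : ℚ) / 7) (by norm_num)) := Units.ext (by norm_num)
  rw [Ne, e, mk_neg_eq_splitDiscriminantClass_iff_of_odd (n := 3) (by decide)]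
  have h := mul_not_mem_normUnitsSubgroup (mem_normUnitsSubgroup_of_sq_add_mul_sq (d := 2) (a := ((2 : ℚ) / 49)) (by norm_num) (0 : ℚ) ((1 : ℚ) / 7) (by norm_num))
    Summit.HodgeConjecture.Ring2WeilNormDescent.seven_not_mem_norm_two
  rw [mk0_mul_mk0] at h
  norm_num at h
  exact h

/-- The same datum, CELL IDENTIFICATION: `[det H|_B] = [-7]` in `ℚˣ/Nm(ℚ(√-2)ˣ)` — the census ROW KEY of `W6.2.7` (`a·7 = (2 : ℚ) = ((0 : ℚ))² + 2·((1 : ℚ))²`).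
research route conditional on HC_CM; not a corollary; Q11.4-sentence-2 already refuted in dim ≥ 3. [cite: vanGeemen1994HodgeAV, Lemma 5.2 (3)] -/
theorem pwSD16L27_242_8a42_4b42_q0_g505_mk_detH_eq_key :
    (QuotientGroup.mk (Units.mk0 (-(((2 : ℚ) / 7))) (neg_ne_zero.2 (by norm_num))) : weilNormResidueGroup 2) =
      QuotientGroup.mk (Units.mk0 (-(7 : ℚ)) (neg_ne_zero.2 (by norm_num))) :=
  mk_neg_eq_mk_neg_of_mul_mem (by norm_num) (by norm_num)
    (mem_normUnitsSubgroup_of_sq_add_mul_sq _ (0 : ℚ) (1 : ℚ) (by norm_num))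

/-- `SD₁₆ × PSL₂(7)` (semidihedral carrier of `ℚ(√-2)`; `PSL₂(7)` on 7 points)-cover `(0; 2:33,8a:42,4b:42)` (genus 617, Hurwitz dimension 0; engine `cosetwin.py` on the coset cover `C̃/(H₁ × Stab(0))`, 56 sheets, genus 11, its own polarisation, exact): the HIDDEN FACTOR `B = V^{H₁×Stab(0)}` of the `(λ⊗ρ)`-piece `P` — an abelian EIGHTFOLD with `(4,4)` `ℚ(√-2)`-action, WEIL TYPE — has literal `det H|_B = 1/7`, `a = 1/7`, `T(a) = [2, 7]`: row `W8.2.7` (NON-split); `r₁ = dim_K H¹(C̃/G₂)_λ = 1`. THEOREM S7 (carrier-free product-window law, census b04.14 (A)) predicts `T(a_B) = [2, 7]` from `r₁ = 1` (`[a_B] = [n]^{r₁}`, `n = 7`) — CONFIRMED.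
research route conditional on HC_CM; not a corollary; Q11.4-sentence-2 already refuted in dim ≥ 3. [cite: vanGeemen1994HodgeAV, (5.4.1)] -/
theorem pwSD16L27_233_8a42_4b42_q0_g617_mk_detH_ne_split :
    (QuotientGroup.mk (Units.mk0 (((1 : ℚ) / 7)) (by norm_num)) : weilNormResidueGroup 2) ≠
      splitDiscriminantClass 4 2 := by
  have e : Units.mk0 (((1 : ℚ) / 7)) (by norm_num) = Units.mk0 ((1 : ℚ) / 7) (by norm_num) := Units.ext (by norm_num)
  rw [Ne, e, mk_eq_splitDiscriminantClass_iff_of_even (n := 4) (by decide)]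
  have h := mul_not_mem_normUnitsSubgroup (mem_normUnitsSubgroup_of_sq_add_mul_sq (d := 2) (a := ((1 : ℚ) / 49)) (by norm_num) ((1 : ℚ) / 7) (0 : ℚ) (by norm_num))
    Summit.HodgeConjecture.Ring2WeilNormDescent.seven_not_mem_norm_two
  rw [mk0_mul_mk0] at h
  norm_num at h
  exact h

/-- The same datum, CELL IDENTIFICATION: `[det H|_B] = [7]` in `ℚˣ/Nm(ℚ(√-2)ˣ)` — the census ROW KEY of `W8.2.7` (`a·7 = (1 : ℚ) = ((1 : ℚ))² + 2·((0 : ℚ))²`).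
research route conditional on HC_CM; not a corollary; Q11.4-sentence-2 already refuted in dim ≥ 3. [cite: vanGeemen1994HodgeAV, Lemma 5.2 (3)] -/
theorem pwSD16L27_233_8a42_4b42_q0_g617_mk_detH_eq_key :
    (QuotientGroup.mk (Units.mk0 (((1 : ℚ) / 7)) (by norm_num)) : weilNormResidueGroup 2) =
      QuotientGroup.mk (Units.mk0 (7 : ℚ) (by norm_num)) :=
  mk_eq_mk_of_mul_mem (by norm_num) (by norm_num)
    (mem_normUnitsSubgroup_of_sq_add_mul_sq _ (1 : ℚ) (0 : ℚ) (by norm_num))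

/-- `SD₁₆ × A₅` (semidihedral carrier of `ℚ(√-2)`; `A₅` on 5 points)-cover `(0; 2:3,8a:22,4b:5A)` (genus 317, Hurwitz dimension 0; engine `cosetwin.py` on the coset cover `C̃/(H₁ × Stab(0))`, 40 sheets, genus 10, its own polarisation, exact): the HIDDEN FACTOR `B = V^{H₁×Stab(0)}` of the `(λ⊗ρ)`-piece `P` — an abelian SIXFOLD with `(3,3)` `ℚ(√-2)`-action, WEIL TYPE — has literal `det H|_B = -1/40`, `a = 1/40`, `T(a) = [2, 5]`: row `W6.2.5` (NON-split); `r₁ = dim_K H¹(C̃/G₂)_λ = 1`. THEOREM S7 (carrier-free product-window law, census b04.14 (A)) predicts `T(a_B) = [2, 5]` from `r₁ = 1` (`[a_B] = [n]^{r₁}`, `n = 5`) — CONFIRMED.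
research route conditional on HC_CM; not a corollary; Q11.4-sentence-2 already refuted in dim ≥ 3. [cite: vanGeemen1994HodgeAV, (5.4.1)] -/
theorem pwSD16A5_23_8a22_4b5A_q0_g317_mk_detH_ne_split :
    (QuotientGroup.mk (Units.mk0 (((-1 : ℚ) / 40)) (by norm_num)) : weilNormResidueGroup 2) ≠
      splitDiscriminantClass 3 2 := by
  have e : Units.mk0 (((-1 : ℚ) / 40)) (by norm_num) = -(Units.mk0 ((1 : ℚ) / 40) (by norm_num)) := Units.ext (by norm_num)
  rw [Ne, e, mk_neg_eq_splitDiscriminantClass_iff_of_odd (n := 3) (by decide)]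
  have h := mul_not_mem_normUnitsSubgroup (mem_normUnitsSubgroup_of_sq_add_mul_sq (d := 2) (a := ((1 : ℚ) / 200)) (by norm_num) (0 : ℚ) ((1 : ℚ) / 20) (by norm_num))
    Summit.HodgeConjecture.Ring2WeilNormDescent.five_not_mem_norm_two
  rw [mk0_mul_mk0] at h
  norm_num at h
  exact h

/-- The same datum, CELL IDENTIFICATION: `[det H|_B] = [-5]` in `ℚˣ/Nm(ℚ(√-2)ˣ)` — the census ROW KEY of `W6.2.5` (`a·5 = ((1 : ℚ) / 8) = ((0 : ℚ))² + 2·(((1 : ℚ) / 4))²`).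
research route conditional on HC_CM; not a corollary; Q11.4-sentence-2 already refuted in dim ≥ 3. [cite: vanGeemen1994HodgeAV, Lemma 5.2 (3)] -/
theorem pwSD16A5_23_8a22_4b5A_q0_g317_mk_detH_eq_key :
    (QuotientGroup.mk (Units.mk0 (-(((1 : ℚ) / 40))) (neg_ne_zero.2 (by norm_num))) : weilNormResidueGroup 2) =
      QuotientGroup.mk (Units.mk0 (-(5 : ℚ)) (neg_ne_zero.2 (by norm_num))) :=
  mk_neg_eq_mk_neg_of_mul_mem (by norm_num) (by norm_num)
    (mem_normUnitsSubgroup_of_sq_add_mul_sq _ (0 : ℚ) ((1 : ℚ) / 4) (by norm_num))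

/-- `SD₁₆ × A₅` (semidihedral carrier of `ℚ(√-2)`; `A₅` on 5 points)-cover `(0; 2:3,8a:22,4b:5B)` (genus 317, Hurwitz dimension 0; engine `cosetwin.py` on the coset cover `C̃/(H₁ × Stab(0))`, 40 sheets, genus 10, its own polarisation, exact): the HIDDEN FACTOR `B = V^{H₁×Stab(0)}` of the `(λ⊗ρ)`-piece `P` — an abelian SIXFOLD with `(3,3)` `ℚ(√-2)`-action, WEIL TYPE — has literal `det H|_B = -1/40`, `a = 1/40`, `T(a) = [2, 5]`: row `W6.2.5` (NON-split); `r₁ = dim_K H¹(C̃/G₂)_λ = 1`. THEOREM S7 (carrier-free product-window law, census b04.14 (A)) predicts `T(a_B) = [2, 5]` from `r₁ = 1` (`[a_B] = [n]^{r₁}`, `n = 5`) — CONFIRMED.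
research route conditional on HC_CM; not a corollary; Q11.4-sentence-2 already refuted in dim ≥ 3. [cite: vanGeemen1994HodgeAV, (5.4.1)] -/
theorem pwSD16A5_23_8a22_4b5B_q0_g317_mk_detH_ne_split :
    (QuotientGroup.mk (Units.mk0 (((-1 : ℚ) / 40)) (by norm_num)) : weilNormResidueGroup 2) ≠
      splitDiscriminantClass 3 2 := by
  have e : Units.mk0 (((-1 : ℚ) / 40)) (by norm_num) = -(Units.mk0 ((1 : ℚ) / 40) (by norm_num)) := Units.ext (by norm_num)
  rw [Ne, e, mk_neg_eq_splitDiscriminantClass_iff_of_odd (n := 3) (by decide)]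
  have h := mul_not_mem_normUnitsSubgroup (mem_normUnitsSubgroup_of_sq_add_mul_sq (d := 2) (a := ((1 : ℚ) / 200)) (by norm_num) (0 : ℚ) ((1 : ℚ) / 20) (by norm_num))
    Summit.HodgeConjecture.Ring2WeilNormDescent.five_not_mem_norm_two
  rw [mk0_mul_mk0] at h
  norm_num at h
  exact h

/-- The same datum, CELL IDENTIFICATION: `[det H|_B] = [-5]` in `ℚˣ/Nm(ℚ(√-2)ˣ)` — the census ROW KEY of `W6.2.5` (`a·5 = ((1 : ℚ) / 8) = ((0 : ℚ))² + 2·(((1 : ℚ) / 4))²`).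
research route conditional on HC_CM; not a corollary; Q11.4-sentence-2 already refuted in dim ≥ 3. [cite: vanGeemen1994HodgeAV, Lemma 5.2 (3)] -/
theorem pwSD16A5_23_8a22_4b5B_q0_g317_mk_detH_eq_key :
    (QuotientGroup.mk (Units.mk0 (-(((1 : ℚ) / 40))) (neg_ne_zero.2 (by norm_num))) : weilNormResidueGroup 2) =
      QuotientGroup.mk (Units.mk0 (-(5 : ℚ)) (neg_ne_zero.2 (by norm_num))) :=
  mk_neg_eq_mk_neg_of_mul_mem (by norm_num) (by norm_num)
    (mem_normUnitsSubgroup_of_sq_add_mul_sq _ (0 : ℚ) ((1 : ℚ) / 4) (by norm_num))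

/-- `SD₁₆ × A₅` (semidihedral carrier of `ℚ(√-2)`; `A₅` on 5 points)-cover `(0; 2:5A,4b:3,8a:22)` (genus 333, Hurwitz dimension 0; engine `cosetwin.py` on the coset cover `C̃/(H₁ × Stab(0))`, 40 sheets, genus 13, its own polarisation, exact): the HIDDEN FACTOR `B = V^{H₁×Stab(0)}` of the `(λ⊗ρ)`-piece `P` — an abelian EIGHTFOLD with `(4,4)` `ℚ(√-2)`-action, WEIL TYPE — has literal `det H|_B = 9/40`, `a = 9/40`, `T(a) = [2, 5]`: row `W8.2.5` (NON-split); `r₁ = dim_K H¹(C̃/G₂)_λ = 1`. THEOREM S7 (carrier-free product-window law, census b04.14 (A)) predicts `T(a_B) = [2, 5]` from `r₁ = 1` (`[a_B] = [n]^{r₁}`, `n = 5`) — CONFIRMED.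
research route conditional on HC_CM; not a corollary; Q11.4-sentence-2 already refuted in dim ≥ 3. [cite: vanGeemen1994HodgeAV, (5.4.1)] -/
theorem pwSD16A5_25A_4b3_8a22_q0_g333_mk_detH_ne_split :
    (QuotientGroup.mk (Units.mk0 (((9 : ℚ) / 40)) (by norm_num)) : weilNormResidueGroup 2) ≠
      splitDiscriminantClass 4 2 := by
  have e : Units.mk0 (((9 : ℚ) / 40)) (by norm_num) = Units.mk0 ((9 : ℚ) / 40) (by norm_num) := Units.ext (by norm_num)
  rw [Ne, e, mk_eq_splitDiscriminantClass_iff_of_even (n := 4) (by decide)]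
  have h := mul_not_mem_normUnitsSubgroup (mem_normUnitsSubgroup_of_sq_add_mul_sq (d := 2) (a := ((9 : ℚ) / 200)) (by norm_num) (0 : ℚ) ((3 : ℚ) / 20) (by norm_num))
    Summit.HodgeConjecture.Ring2WeilNormDescent.five_not_mem_norm_two
  rw [mk0_mul_mk0] at h
  norm_num at h
  exact h

/-- The same datum, CELL IDENTIFICATION: `[det H|_B] = [5]` in `ℚˣ/Nm(ℚ(√-2)ˣ)` — the census ROW KEY of `W8.2.5` (`a·5 = ((9 : ℚ) / 8) = ((0 : ℚ))² + 2·(((3 : ℚ) / 4))²`).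
research route conditional on HC_CM; not a corollary; Q11.4-sentence-2 already refuted in dim ≥ 3. [cite: vanGeemen1994HodgeAV, Lemma 5.2 (3)] -/
theorem pwSD16A5_25A_4b3_8a22_q0_g333_mk_detH_eq_key :
    (QuotientGroup.mk (Units.mk0 (((9 : ℚ) / 40)) (by norm_num)) : weilNormResidueGroup 2) =
      QuotientGroup.mk (Units.mk0 (5 : ℚ) (by norm_num)) :=
  mk_eq_mk_of_mul_mem (by norm_num) (by norm_num)
    (mem_normUnitsSubgroup_of_sq_add_mul_sq _ (0 : ℚ) ((3 : ℚ) / 4) (by norm_num))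

/-- `SD₁₆ × A₅` (semidihedral carrier of `ℚ(√-2)`; `A₅` on 5 points)-cover `(0; 2:5A,4b:5B,8a:22)` (genus 349, Hurwitz dimension 0; engine `cosetwin.py` on the coset cover `C̃/(H₁ × Stab(0))`, 40 sheets, genus 15, its own polarisation, exact): the HIDDEN FACTOR `B = V^{H₁×Stab(0)}` of the `(λ⊗ρ)`-piece `P` — an abelian EIGHTFOLD with `(4,4)` `ℚ(√-2)`-action, WEIL TYPE — has literal `det H|_B = 3/320`, `a = 3/320`, `T(a) = [2, 5]`: row `W8.2.5` (NON-split); `r₁ = dim_K H¹(C̃/G₂)_λ = 1`. THEOREM S7 (carrier-free product-window law, census b04.14 (A)) predicts `T(a_B) = [2, 5]` from `r₁ = 1` (`[a_B] = [n]^{r₁}`, `n = 5`) — CONFIRMED.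
research route conditional on HC_CM; not a corollary; Q11.4-sentence-2 already refuted in dim ≥ 3. [cite: vanGeemen1994HodgeAV, (5.4.1)] -/
theorem pwSD16A5_25A_4b5B_8a22_q0_g349_mk_detH_ne_split :
    (QuotientGroup.mk (Units.mk0 (((3 : ℚ) / 320)) (by norm_num)) : weilNormResidueGroup 2) ≠
      splitDiscriminantClass 4 2 := by
  have e : Units.mk0 (((3 : ℚ) / 320)) (by norm_num) = Units.mk0 ((3 : ℚ) / 320) (by norm_num) := Units.ext (by norm_num)
  rw [Ne, e, mk_eq_splitDiscriminantClass_iff_of_even (n := 4) (by decide)]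
  have h := mul_not_mem_normUnitsSubgroup (mem_normUnitsSubgroup_of_sq_add_mul_sq (d := 2) (a := ((3 : ℚ) / 1600)) (by norm_num) ((1 : ℚ) / 40) ((1 : ℚ) / 40) (by norm_num))
    Summit.HodgeConjecture.Ring2WeilNormDescent.five_not_mem_norm_two
  rw [mk0_mul_mk0] at h
  norm_num at h
  exact h

/-- The same datum, CELL IDENTIFICATION: `[det H|_B] = [5]` in `ℚˣ/Nm(ℚ(√-2)ˣ)` — the census ROW KEY of `W8.2.5` (`a·5 = ((3 : ℚ) / 64) = (((1 : ℚ) / 8))² + 2·(((1 : ℚ) / 8))²`).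
research route conditional on HC_CM; not a corollary; Q11.4-sentence-2 already refuted in dim ≥ 3. [cite: vanGeemen1994HodgeAV, Lemma 5.2 (3)] -/
theorem pwSD16A5_25A_4b5B_8a22_q0_g349_mk_detH_eq_key :
    (QuotientGroup.mk (Units.mk0 (((3 : ℚ) / 320)) (by norm_num)) : weilNormResidueGroup 2) =
      QuotientGroup.mk (Units.mk0 (5 : ℚ) (by norm_num)) :=
  mk_eq_mk_of_mul_mem (by norm_num) (by norm_num)
    (mem_normUnitsSubgroup_of_sq_add_mul_sq _ ((1 : ℚ) / 8) ((1 : ℚ) / 8) (by norm_num))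

/-- `SD₁₆ × F₂₀` (semidihedral carrier of `ℚ(√-2)`; `F₂₀ = AGL(1,5)`)-cover `(0; 2:22,4a:4A,4b:22,8a:4B)` (genus 141, Hurwitz dimension 1; engine `cosetwin.py` on the coset cover `C̃/(H₁ × Stab(0))`, 40 sheets, genus 18, its own polarisation, exact): the HIDDEN FACTOR `B = V^{H₁×Stab(0)}` of the `(λ⊗ρ)`-piece `P` — an abelian TENFOLD with `(5,5)` `ℚ(√-2)`-action, WEIL TYPE — has literal `det H|_B = -3/250`, `a = 3/250`, `T(a) = [2, 5]`: row `W10.2.5` (NON-split); `r₁ = dim_K H¹(C̃/G₂)_λ = 3`. THEOREM S7 (carrier-free product-window law, census b04.14 (A)) predicts `T(a_B) = [2, 5]` from `r₁ = 3` (`[a_B] = [n]^{r₁}`, `n = 5`) — CONFIRMED.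
research route conditional on HC_CM; not a corollary; Q11.4-sentence-2 already refuted in dim ≥ 3. [cite: vanGeemen1994HodgeAV, (5.4.1)] -/
theorem pwSD16F20_222_4a4A_4b22_8a4B_q0_g141_mk_detH_ne_split :
    (QuotientGroup.mk (Units.mk0 (((-3 : ℚ) / 250)) (by norm_num)) : weilNormResidueGroup 2) ≠
      splitDiscriminantClass 5 2 := by
  have e : Units.mk0 (((-3 : ℚ) / 250)) (by norm_num) = -(Units.mk0 ((3 : ℚ) / 250) (by norm_num)) := Units.ext (by norm_num)
  rw [Ne, e, mk_neg_eq_splitDiscriminantClass_iff_of_odd (n := 5) (by decide)]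
  have h := mul_not_mem_normUnitsSubgroup (mem_normUnitsSubgroup_of_sq_add_mul_sq (d := 2) (a := ((3 : ℚ) / 1250)) (by norm_num) ((-1 : ℚ) / 25) ((1 : ℚ) / 50) (by norm_num))
    Summit.HodgeConjecture.Ring2WeilNormDescent.five_not_mem_norm_two
  rw [mk0_mul_mk0] at h
  norm_num at h
  exact h

/-- The same datum, CELL IDENTIFICATION: `[det H|_B] = [-5]` in `ℚˣ/Nm(ℚ(√-2)ˣ)` — the census ROW KEY of `W10.2.5` (`a·5 = ((3 : ℚ) / 50) = (((-1 : ℚ) / 5))² + 2·(((1 : ℚ) / 10))²`).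
research route conditional on HC_CM; not a corollary; Q11.4-sentence-2 already refuted in dim ≥ 3. [cite: vanGeemen1994HodgeAV, Lemma 5.2 (3)] -/
theorem pwSD16F20_222_4a4A_4b22_8a4B_q0_g141_mk_detH_eq_key :
    (QuotientGroup.mk (Units.mk0 (-(((3 : ℚ) / 250))) (neg_ne_zero.2 (by norm_num))) : weilNormResidueGroup 2) =
      QuotientGroup.mk (Units.mk0 (-(5 : ℚ)) (neg_ne_zero.2 (by norm_num))) :=
  mk_neg_eq_mk_neg_of_mul_mem (by norm_num) (by norm_num)
    (mem_normUnitsSubgroup_of_sq_add_mul_sq _ ((-1 : ℚ) / 5) ((1 : ℚ) / 10) (by norm_num))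

/-- `SD₁₆ × F₂₀` (semidihedral carrier of `ℚ(√-2)`; `F₂₀ = AGL(1,5)`)-cover `(0; 2:22,2:4A,8a:22,8a:4B)` (genus 161, Hurwitz dimension 1; engine `cosetwin.py` on the coset cover `C̃/(H₁ × Stab(0))`, 40 sheets, genus 19, its own polarisation, exact): the HIDDEN FACTOR `B = V^{H₁×Stab(0)}` of the `(λ⊗ρ)`-piece `P` — an abelian TENFOLD with `(5,5)` `ℚ(√-2)`-action, WEIL TYPE — has literal `det H|_B = -17/400`, `a = 17/400`, `T(a) = []`: row `W10.2.1` (SPLIT); `r₁ = dim_K H¹(C̃/G₂)_λ = 2`. THEOREM S7 (carrier-free product-window law, census b04.14 (A)) predicts `T(a_B) = []` from `r₁ = 2` (`[a_B] = [n]^{r₁}`, `n = 5`) — CONFIRMED.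
research route conditional on HC_CM; not a corollary; Q11.4-sentence-2 already refuted in dim ≥ 3. [cite: vanGeemen1994HodgeAV, (5.4.1)] -/
theorem pwSD16F20_222_24A_8a22_8a4B_q0_g161_mk_detH_eq_split :
    (QuotientGroup.mk (Units.mk0 (((-17 : ℚ) / 400)) (by norm_num)) : weilNormResidueGroup 2) =
      splitDiscriminantClass 5 2 := by
  have e : Units.mk0 (((-17 : ℚ) / 400)) (by norm_num) = -(Units.mk0 ((17 : ℚ) / 400) (by norm_num)) := Units.ext (by norm_num)
  rw [e, mk_neg_eq_splitDiscriminantClass_iff_of_odd (n := 5) (by decide)]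
  exact mem_normUnitsSubgroup_of_sq_add_mul_sq _ ((3 : ℚ) / 20) ((1 : ℚ) / 10) (by norm_num)

/-- `SD₁₆ × F₂₀` (semidihedral carrier of `ℚ(√-2)`; `F₂₀ = AGL(1,5)`)-cover `(0; e:4A,2:22,8a:22,4b:4B)` (genus 141, Hurwitz dimension 1; engine `cosetwin.py` on the coset cover `C̃/(H₁ × Stab(0))`, 40 sheets, genus 15, its own polarisation, exact): the HIDDEN FACTOR `B = V^{H₁×Stab(0)}` of the `(λ⊗ρ)`-piece `P` — an abelian EIGHTFOLD with `(4,4)` `ℚ(√-2)`-action, WEIL TYPE — has literal `det H|_B = 3/80`, `a = 3/80`, `T(a) = [2, 5]`: row `W8.2.5` (NON-split); `r₁ = dim_K H¹(C̃/G₂)_λ = 1`. THEOREM S7 (carrier-free product-window law, census b04.14 (A)) predicts `T(a_B) = [2, 5]` from `r₁ = 1` (`[a_B] = [n]^{r₁}`, `n = 5`) — CONFIRMED.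
research route conditional on HC_CM; not a corollary; Q11.4-sentence-2 already refuted in dim ≥ 3. [cite: vanGeemen1994HodgeAV, (5.4.1)] -/
theorem pwSD16F20_e4A_222_8a22_4b4B_q0_g141_mk_detH_ne_split :
    (QuotientGroup.mk (Units.mk0 (((3 : ℚ) / 80)) (by norm_num)) : weilNormResidueGroup 2) ≠
      splitDiscriminantClass 4 2 := by
  have e : Units.mk0 (((3 : ℚ) / 80)) (by norm_num) = Units.mk0 ((3 : ℚ) / 80) (by norm_num) := Units.ext (by norm_num)
  rw [Ne, e, mk_eq_splitDiscriminantClass_iff_of_even (n := 4) (by decide)]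
  have h := mul_not_mem_normUnitsSubgroup (mem_normUnitsSubgroup_of_sq_add_mul_sq (d := 2) (a := ((3 : ℚ) / 400)) (by norm_num) ((1 : ℚ) / 20) ((1 : ℚ) / 20) (by norm_num))
    Summit.HodgeConjecture.Ring2WeilNormDescent.five_not_mem_norm_two
  rw [mk0_mul_mk0] at h
  norm_num at h
  exact h

/-- The same datum, CELL IDENTIFICATION: `[det H|_B] = [5]` in `ℚˣ/Nm(ℚ(√-2)ˣ)` — the census ROW KEY of `W8.2.5` (`a·5 = ((3 : ℚ) / 16) = (((1 : ℚ) / 4))² + 2·(((1 : ℚ) / 4))²`).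
research route conditional on HC_CM; not a corollary; Q11.4-sentence-2 already refuted in dim ≥ 3. [cite: vanGeemen1994HodgeAV, Lemma 5.2 (3)] -/
theorem pwSD16F20_e4A_222_8a22_4b4B_q0_g141_mk_detH_eq_key :
    (QuotientGroup.mk (Units.mk0 (((3 : ℚ) / 80)) (by norm_num)) : weilNormResidueGroup 2) =
      QuotientGroup.mk (Units.mk0 (5 : ℚ) (by norm_num)) :=
  mk_eq_mk_of_mul_mem (by norm_num) (by norm_num)
    (mem_normUnitsSubgroup_of_sq_add_mul_sq _ ((1 : ℚ) / 4) ((1 : ℚ) / 4) (by norm_num))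

/-- `C₃ × F₂₀` (`F₂₀ = AGL(1,5)` on 5 points)-cover `(0; c0:4A,c0:4B,c1:22,c1:22,c1:e)` (genus 56, Hurwitz dimension 2; engine `prodwin.py`, exact): the HIDDEN FACTOR `B = V^{H₁×Stab(0)}` of the `(λ⊗ρ)`-piece `P` (`P ~ B^{4}`, census row of `P`: `W40.3.1`) — an abelian TENFOLD with `(5,5)` `ℚ(√-3)`-action, WEIL TYPE — has literal `det H|_B = -67108864/15`, `a = 67108864/15`, `T(a) = [3, 5]`: row `W10.3.5` (NON-split); `r₁ = dim_K H¹(C̃/G₂)_λ = 1`. THEOREM S6 (product-window law, census b04.13 (A)) predicts `T(a_B) = [3, 5]` from `r₁ = 1`, `r_H = 11` — CONFIRMED.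
research route conditional on HC_CM; not a corollary; Q11.4-sentence-2 already refuted in dim ≥ 3. [cite: vanGeemen1994HodgeAV, (5.4.1)] -/
theorem pwC3F20_c04A_c04B_c122_c122_c1e_q0_g56_mk_detH_ne_split :
    (QuotientGroup.mk (Units.mk0 (((-67108864 : ℚ) / 15)) (by norm_num)) : weilNormResidueGroup 3) ≠
      splitDiscriminantClass 5 3 := by
  have e : Units.mk0 (((-67108864 : ℚ) / 15)) (by norm_num) = -(Units.mk0 ((67108864 : ℚ) / 15) (by norm_num)) := Units.ext (by norm_num)
  rw [Ne, e, mk_neg_eq_splitDiscriminantClass_iff_of_odd (n := 5) (by decide)]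
  have h := mul_not_mem_normUnitsSubgroup (mem_normUnitsSubgroup_of_sq_add_mul_sq (d := 3) (a := ((67108864 : ℚ) / 75)) (by norm_num) (0 : ℚ) ((8192 : ℚ) / 15) (by norm_num))
    Summit.HodgeConjecture.Ring2WeilNormDescent.five_not_mem_norm_three
  rw [mk0_mul_mk0] at h
  norm_num at h
  exact h

/-- The same datum, CELL IDENTIFICATION: `[det H|_B] = [-5]` in `ℚˣ/Nm(ℚ(√-3)ˣ)` — the census ROW KEY of `W10.3.5` (`a·5 = ((67108864 : ℚ) / 3) = ((0 : ℚ))² + 3·(((8192 : ℚ) / 3))²`).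
research route conditional on HC_CM; not a corollary; Q11.4-sentence-2 already refuted in dim ≥ 3. [cite: vanGeemen1994HodgeAV, Lemma 5.2 (3)] -/
theorem pwC3F20_c04A_c04B_c122_c122_c1e_q0_g56_mk_detH_eq_key :
    (QuotientGroup.mk (Units.mk0 (-(((67108864 : ℚ) / 15))) (neg_ne_zero.2 (by norm_num))) : weilNormResidueGroup 3) =
      QuotientGroup.mk (Units.mk0 (-(5 : ℚ)) (neg_ne_zero.2 (by norm_num))) :=
  mk_neg_eq_mk_neg_of_mul_mem (by norm_num) (by norm_num)
    (mem_normUnitsSubgroup_of_sq_add_mul_sq _ (0 : ℚ) ((8192 : ℚ) / 3) (by norm_num))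

end Summit.HodgeConjecture.HodgeConjecture.Ring2.WeilCoverage
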